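import Summits.AtomisticToContinuum.BoseEinsteinCondensation.Theses.BECStronglyRayleigh
import Summits.AtomisticToContinuum.BoseEinsteinCondensation.Theorems.InsertionFieldDelocalisation.Negative.Toolkit
import Summits.AtomisticToContinuum.BoseEinsteinCondensation.Theorems.InsertionFieldDelocalisation.Negative.Tightness
import Literature.MathematicalPhysics.QuantumLattice.LiebMattisLadder
import HarnessLib

/-!
# PO averaging, deterministic part II: floors, the size of the constants, flat components, and
# the sector of the Penrose–Onsager vector
# (helper for stub `stub_poAveraging` of line `cosh-budget-penrose-onsager`, crux
# `BECStronglyRayleigh.InsertionFieldDelocalisation`, stmt-AtomisticToContinuum-9673)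

Conventions of `Theorems/InsertionFieldDelocalisation/Negative/Toolkit.lean` (`field`, `K1lhs`,
`K1rhs`, `K1Ineq`; occupied = index `0`; `1_S = fun z => if z ∈ S then 0 else 1`); the one-particle
field `u^T_x = [x ∉ T] Re ψ(1_{T ∪ x})` and the PO vector
`Φ = A†ψ : σ ↦ Σ_{x : σ_x = 0} ψ(σ with x emptied)` are written out.

* `cb2po_K1lhs_smul`, `cb2po_K1rhs_smul`, `cb2po_K1lhs_flat`, `cb2po_K1rhs_flat` : scaling of the two
  functionals and their values `2c²`, `#K·c²` on a flat field `c·1_K` (the flat components of the PO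
  mixtures sit exactly at the Cauchy–Schwarz floor).
* `cb2po_floor_le_const` : the hypothesis `K1Ineq M L N ψ` of the stub at an admissible level-`N`
  datum forces `2L³ ≤ (L³ - N + 2)·M` (so `M ≥ 2`: the degenerate inputs `M ≤ 0` do not occur);
  `cb2po_sum_K1rhs_one_pos`, `cb2po_floor_le_const_one` : the one-particle twin,
  `2L³ ≤ (L³ - N + 1)·M₁`.
* `cb2po_poVec_mem_sector` : `Φ = A†ψ` lies in the sector of `N + 1` particles when `ψ` lies in the
  sector of `N < |Λ|` particles.
* `stub_poAveragingFloors` : the registered sub-goal (both floor bounds for the stub's hypotheses).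
-/

noncomputable section

open scoped BigOperators ComplexOrder
open Literature.MathematicalPhysics.QuantumLattice Literature.Probability.LatticeModels Matrix Finset
open Summit.AtomisticToContinuum.BoseEinsteinCondensation.Theses.BECStronglyRayleigh
open Summit.AtomisticToContinuum.BoseEinsteinCondensation.Theorems.InsertionFieldDelocalisation.Negative

namespace Summit.AtomisticToContinuum.BoseEinsteinCondensation.Cruxes.InsertionFieldDelocalisation.CoshBudgetPenroseOnsager

section Flat

variable {ι : Type*} [Fintype ι]

/-- Scaling of the flatness functional: `‖c r‖²Φ(c r) = c² ‖r‖²Φ(r)` (also with Lean's `x/0 = 0`).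
[folklore] -/
theorem cb2po_K1lhs_smul (c : ℝ) (r : ι → ℝ) : K1lhs (fun x => c * r x) = c ^ 2 * K1lhs r := by
  simp only [K1lhs, mul_pow, ← Finset.mul_sum]
  by_cases hc : c = 0
  · subst hc
    simp
  have h3 : (c ^ 3 * ∑ x, r x ^ 3) / (c * ∑ x, r x) = c ^ 2 * ((∑ x, r x ^ 3) / ∑ x, r x) := by
    rw [show c ^ 3 * ∑ x, r x ^ 3 = c * (c ^ 2 * ∑ x, r x ^ 3) by ring,
      mul_div_mul_left _ _ hc, mul_div_assoc]
  have h2 : (c ^ 2) ^ 2 * (∑ x, r x ^ 2) ^ 2 / (c ^ 2 * (∑ x, r x) ^ 2) =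
      c ^ 2 * ((∑ x, r x ^ 2) ^ 2 / (∑ x, r x) ^ 2) := by
    rw [show (c ^ 2) ^ 2 * (∑ x, r x ^ 2) ^ 2 = c ^ 2 * (c ^ 2 * (∑ x, r x ^ 2) ^ 2) by ring,
      mul_div_mul_left _ _ (pow_ne_zero 2 hc), mul_div_assoc]
  rw [h3, h2, mul_add]

/-- Scaling of the `ω`-weight: `‖c r‖² = c² ‖r‖²`. [folklore] -/
theorem cb2po_K1rhs_smul (c : ℝ) (r : ι → ℝ) : K1rhs (fun x => c * r x) = c ^ 2 * K1rhs r := by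
  simp only [K1rhs, mul_pow, ← Finset.mul_sum]

/-- A flat field `c·1_K` on a nonempty set `K` has flatness functional `2c²` — the flat components
of the PO mixtures sit exactly at the Cauchy–Schwarz floor `2‖r‖²/#K`. [folklore] -/
theorem cb2po_K1lhs_flat (p : ι → Prop) [DecidablePred p] (hp : 0 < (Finset.univ.filter p).card)
    (c : ℝ) : K1lhs (fun x => if p x then c else 0) = 2 * c ^ 2 := by
  have h : (fun x => if p x then c else 0) = fun x => c * (if p x then (1 : ℝ) else 0) := by
    funext x
    split_ifs <;> simp
  rw [h, cb2po_K1lhs_smul, K1lhs_boolIndicator p hp]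
  ring

/-- A flat field `c·1_K` has `ω`-weight `#K · c²`. [folklore] -/
theorem cb2po_K1rhs_flat (p : ι → Prop) [DecidablePred p] (c : ℝ) :
    K1rhs (fun x => if p x then c else 0) = ((Finset.univ.filter p).card : ℝ) * c ^ 2 := by
  have h : (fun x => if p x then c else 0) = fun x => c * (if p x then (1 : ℝ) else 0) := by
    funext x
    split_ifs <;> simp
  rw [h, cb2po_K1rhs_smul, K1rhs_boolIndicator p]
  ring

end Flat

section Floors

variable {L : ℕ} [NeZero L]

/-- **The two-particle hypothesis forces `M ≥ 2L³/(L³ - N + 2)`.** If an admissible level-`N` datum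
(sector `N - L³/2`, nonzero, entrywise real nonnegative; `2 ≤ N ≤ L³`) satisfies `K1Ineq M L N ψ`,
then `2L³ ≤ (L³ - N + 2)·M`; in particular `M ≥ 2 > 0`, so the degenerate constants `M ≤ 0` never
satisfy the hypothesis of `stub_poAveraging`. (Cauchy–Schwarz floor `K1_floor_field` summed over the
backgrounds, and `sum_K1rhs_pos`.) [folklore] -/
theorem cb2po_floor_le_const {N : ℕ} (hN : 2 ≤ N) (hNL : N ≤ L ^ 3) {M : ℝ}
    {ψ : TensorIndex (TorusSite 3 L) 2 → ℂ} (hsec : ψ ∈ spinZSector 1 ((N : ℝ) - (L : ℝ) ^ 3 / 2))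
    (hne : ψ ≠ 0) (hnn : ∀ σ, 0 ≤ (ψ σ).re ∧ (ψ σ).im = 0) (hK : K1Ineq M L N ψ) :
    2 * (L : ℝ) ^ 3 ≤ ((L : ℝ) ^ 3 - N + 2) * M := by
  -- adapted from `Negative.const_lower_bound` (Tightness.lean), with the crux hypothesis localised
  have hpos := sum_K1rhs_pos ψ N hN _ (by rw [card_torusSite 3 L]; push_cast; ring) hsec hne hnn
  rw [K1Ineq] at hK
  set A := ∑ T ∈ (Finset.univ : Finset (TorusSite 3 L)).powersetCard (N - 2), K1lhs (field ψ T)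
  set B := ∑ T ∈ (Finset.univ : Finset (TorusSite 3 L)).powersetCard (N - 2), K1rhs (field ψ T)
  have hKN : ∀ T ∈ (Finset.univ : Finset (TorusSite 3 L)).powersetCard (N - 2),
      ((Fintype.card (TorusSite 3 L) - T.card : ℕ) : ℝ) = (L : ℝ) ^ 3 - N + 2 := by
    intro T hT
    rw [(Finset.mem_powersetCard.mp hT).2, card_torusSite 3 L]
    have h1 : N - 2 ≤ L ^ 3 := by omega
    rw [Nat.cast_sub h1, Nat.cast_sub (by omega : 2 ≤ N)]
    push_cast
    ring
  have hfloor : 2 * B ≤ ((L : ℝ) ^ 3 - N + 2) * A := by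
    have h : ∀ T ∈ (Finset.univ : Finset (TorusSite 3 L)).powersetCard (N - 2),
        2 * K1rhs (field ψ T) ≤ ((L : ℝ) ^ 3 - N + 2) * K1lhs (field ψ T) := by
      intro T hT
      rw [← hKN T hT]
      exact K1_floor_field ψ (fun σ => (hnn σ).1) T
    calc 2 * B = ∑ T ∈ (Finset.univ : Finset (TorusSite 3 L)).powersetCard (N - 2),
          2 * K1rhs (field ψ T) := by rw [Finset.mul_sum]
      _ ≤ ∑ T ∈ (Finset.univ : Finset (TorusSite 3 L)).powersetCard (N - 2),
          ((L : ℝ) ^ 3 - N + 2) * K1lhs (field ψ T) := Finset.sum_le_sum h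
      _ = ((L : ℝ) ^ 3 - N + 2) * A := by rw [← Finset.mul_sum]
  have hK0 : (0 : ℝ) < (L : ℝ) ^ 3 - N + 2 := by
    have : (N : ℝ) ≤ (L : ℝ) ^ 3 := by exact_mod_cast hNL
    linarith
  have hL0 : (0 : ℝ) < (L : ℝ) ^ 3 := pow_pos (Nat.cast_pos.mpr (Nat.pos_of_ne_zero (NeZero.ne L))) 3
  have h1 : 2 * (L : ℝ) ^ 3 * B ≤ ((L : ℝ) ^ 3 - N + 2) * M * B :=
    calc 2 * (L : ℝ) ^ 3 * B = (L : ℝ) ^ 3 * (2 * B) := by ring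
      _ ≤ (L : ℝ) ^ 3 * (((L : ℝ) ^ 3 - N + 2) * A) := mul_le_mul_of_nonneg_left hfloor hL0.le
      _ = ((L : ℝ) ^ 3 - N + 2) * ((L : ℝ) ^ 3 * A) := by ring
      _ ≤ ((L : ℝ) ^ 3 - N + 2) * (M * B) := mul_le_mul_of_nonneg_left hK hK0.le
      _ = ((L : ℝ) ^ 3 - N + 2) * M * B := by ring
  exact le_of_mul_le_mul_right h1 hpos

/-- **The one-particle `ω`-weights of an admissible vector are not all zero**: for a nonzero
nonnegative sector-`N` vector (`N ≥ 1`), `Σ_{|T| = N-1} ‖u^T‖² > 0` (take `T = S ∖ x` for a charged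
`N`-set `S ∋ x`). [folklore] -/
theorem cb2po_sum_K1rhs_one_pos {N : ℕ} (hN : 1 ≤ N) {ψ : TensorIndex (TorusSite 3 L) 2 → ℂ}
    (hsec : ψ ∈ spinZSector 1 ((N : ℝ) - (L : ℝ) ^ 3 / 2)) (hne : ψ ≠ 0)
    (hnn : ∀ σ, 0 ≤ (ψ σ).re ∧ (ψ σ).im = 0) :
    0 < ∑ T ∈ (univ : Finset (TorusSite 3 L)).powersetCard (N - 1),
      K1rhs (fun x => if x ∉ T then (ψ (fun z => if z ∈ insert x T then 0 else 1)).re else 0) := by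
  obtain ⟨S, hS, hpos⟩ := exists_occSet_pos ψ N ((N : ℝ) - (L : ℝ) ^ 3 / 2)
    (by rw [card_torusSite 3 L]; push_cast; ring) hsec hne hnn
  obtain ⟨x, hx⟩ : S.Nonempty := Finset.card_pos.mp (by omega)
  set T := S.erase x with hT
  have hxT : x ∉ T := Finset.notMem_erase x S
  have hTS : insert x T = S := Finset.insert_erase hx
  have hTmem : T ∈ (univ : Finset (TorusSite 3 L)).powersetCard (N - 1) :=
    Finset.mem_powersetCard.mpr ⟨Finset.subset_univ T, by rw [hT, Finset.card_erase_of_mem hx, hS]⟩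
  have hux : 0 < (if x ∉ T then (ψ (fun z => if z ∈ insert x T then 0 else 1)).re else 0) := by
    rw [if_pos hxT, hTS]
    exact hpos
  have hK1 : 0 < K1rhs (fun y => if y ∉ T then (ψ (fun z => if z ∈ insert y T then 0 else 1)).re
      else 0) := by
    rw [K1rhs]
    refine lt_of_lt_of_le (pow_pos hux 2) ?_
    exact Finset.single_le_sum (f := fun y => (if y ∉ T then
      (ψ (fun z => if z ∈ insert y T then 0 else 1)).re else 0) ^ 2) (fun y _ => sq_nonneg _)
      (Finset.mem_univ x)
  refine lt_of_lt_of_le hK1 ?_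
  exact Finset.single_le_sum (f := fun T' => K1rhs (fun y => if y ∉ T' then
    (ψ (fun z => if z ∈ insert y T' then 0 else 1)).re else 0))
    (fun T' _ => Finset.sum_nonneg fun y _ => sq_nonneg _) hTmem

/-- **The one-particle hypothesis forces `M₁ ≥ 2L³/(L³ - N + 1)`.** If an admissible level-`N` datum
(`1 ≤ N ≤ L³`) satisfies the one-particle inequality `L³ Σ_{|T|=N-1} ‖u^T‖²Φ(u^T) ≤ M₁ Σ_T ‖u^T‖²`,
then `2L³ ≤ (L³ - N + 1)·M₁`; in particular `M₁ ≥ 2 > 0`. (Floor `K1_floor` on the support `Tᶜ` of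
`u^T`, `|Tᶜ| = L³ - N + 1`, and `cb2po_sum_K1rhs_one_pos`.) [folklore] -/
theorem cb2po_floor_le_const_one {N : ℕ} (hN : 1 ≤ N) (hNL : N ≤ L ^ 3) {M₁ : ℝ}
    {ψ : TensorIndex (TorusSite 3 L) 2 → ℂ} (hsec : ψ ∈ spinZSector 1 ((N : ℝ) - (L : ℝ) ^ 3 / 2))
    (hne : ψ ≠ 0) (hnn : ∀ σ, 0 ≤ (ψ σ).re ∧ (ψ σ).im = 0)
    (hK : (L : ℝ) ^ 3 * ∑ T ∈ (univ : Finset (TorusSite 3 L)).powersetCard (N - 1),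
        K1lhs (fun x => if x ∉ T then (ψ (fun z => if z ∈ insert x T then 0 else 1)).re else 0) ≤
      M₁ * ∑ T ∈ (univ : Finset (TorusSite 3 L)).powersetCard (N - 1),
        K1rhs (fun x => if x ∉ T then (ψ (fun z => if z ∈ insert x T then 0 else 1)).re else 0)) :
    2 * (L : ℝ) ^ 3 ≤ ((L : ℝ) ^ 3 - N + 1) * M₁ := by
  have hpos := cb2po_sum_K1rhs_one_pos hN hsec hne hnn
  set u : Finset (TorusSite 3 L) → TorusSite 3 L → ℝ := fun T x =>
    if x ∉ T then (ψ (fun z => if z ∈ insert x T then 0 else 1)).re else 0 with hu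
  set A := ∑ T ∈ (Finset.univ : Finset (TorusSite 3 L)).powersetCard (N - 1), K1lhs (u T)
  set B := ∑ T ∈ (Finset.univ : Finset (TorusSite 3 L)).powersetCard (N - 1), K1rhs (u T)
  have hu0 : ∀ T x, 0 ≤ u T x := fun T x => by
    simp only [hu]
    split_ifs
    · exact le_rfl
    · exact (hnn _).1
  have hfloor : 2 * B ≤ ((L : ℝ) ^ 3 - N + 1) * A := by
    have h : ∀ T ∈ (Finset.univ : Finset (TorusSite 3 L)).powersetCard (N - 1),
        2 * K1rhs (u T) ≤ ((L : ℝ) ^ 3 - N + 1) * K1lhs (u T) := by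
      intro T hT
      have hf := K1_floor (u T) (hu0 T) Tᶜ fun x hx => by
        simp only [hu]
        rw [if_neg (by simpa using hx)]
      rw [Finset.card_compl, (Finset.mem_powersetCard.mp hT).2, card_torusSite 3 L,
        Nat.cast_sub (by omega : N - 1 ≤ L ^ 3), Nat.cast_sub hN] at hf
      push_cast at hf
      convert hf using 2
      ring
    calc 2 * B = ∑ T ∈ (Finset.univ : Finset (TorusSite 3 L)).powersetCard (N - 1),
          2 * K1rhs (u T) := by rw [Finset.mul_sum]
      _ ≤ ∑ T ∈ (Finset.univ : Finset (TorusSite 3 L)).powersetCard (N - 1),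
          ((L : ℝ) ^ 3 - N + 1) * K1lhs (u T) := Finset.sum_le_sum h
      _ = ((L : ℝ) ^ 3 - N + 1) * A := by rw [← Finset.mul_sum]
  have hK0 : (0 : ℝ) < (L : ℝ) ^ 3 - N + 1 := by
    have : (N : ℝ) ≤ (L : ℝ) ^ 3 := by exact_mod_cast hNL
    linarith
  have hL0 : (0 : ℝ) < (L : ℝ) ^ 3 := pow_pos (Nat.cast_pos.mpr (Nat.pos_of_ne_zero (NeZero.ne L))) 3
  have h1 : 2 * (L : ℝ) ^ 3 * B ≤ ((L : ℝ) ^ 3 - N + 1) * M₁ * B :=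
    calc 2 * (L : ℝ) ^ 3 * B = (L : ℝ) ^ 3 * (2 * B) := by ring
      _ ≤ (L : ℝ) ^ 3 * (((L : ℝ) ^ 3 - N + 1) * A) := mul_le_mul_of_nonneg_left hfloor hL0.le
      _ = ((L : ℝ) ^ 3 - N + 1) * ((L : ℝ) ^ 3 * A) := by ring
      _ ≤ ((L : ℝ) ^ 3 - N + 1) * (M₁ * B) := mul_le_mul_of_nonneg_left hK hK0.le
      _ = ((L : ℝ) ^ 3 - N + 1) * M₁ * B := by ring
  exact le_of_mul_le_mul_right h1 hpos

end Floors

section Sector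

variable {Λ : Type*} [Fintype Λ] [DecidableEq Λ]

/-- Emptying an occupied site raises the weight (number of empty sites) by one. [folklore] -/
theorem cb2po_weight_update {σ : TensorIndex Λ 2} {x : Λ} (hx : σ x = 0) :
    (∑ z, ((Function.update σ x 1 z : Fin 2) : ℕ)) = (∑ z, (σ z : ℕ)) + 1 := by
  rw [← Finset.add_sum_erase _ _ (Finset.mem_univ x),
    ← Finset.add_sum_erase _ (fun z => (σ z : ℕ)) (Finset.mem_univ x), Function.update_self, hx]
  have h : ∑ z ∈ Finset.univ.erase x, ((Function.update σ x 1 z : Fin 2) : ℕ) =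
      ∑ z ∈ Finset.univ.erase x, (σ z : ℕ) :=
    Finset.sum_congr rfl fun z hz => by rw [Function.update_of_ne (Finset.ne_of_mem_erase hz)]
  rw [h]
  simp only [Fin.val_one, Fin.val_zero]
  ring

/-- **The PO vector raises the particle number by one**: if `ψ` lies in the sector of `N` particles
(`S³_tot = N - |Λ|/2`, `N < |Λ|`), then `Φ = A†ψ` lies in the sector of `N + 1` particles. [folklore] -/
theorem cb2po_poVec_mem_sector (ψ Φ : TensorIndex Λ 2 → ℂ)
    (hΦ : ∀ σ, Φ σ = ∑ x, if σ x = 0 then ψ (Function.update σ x 1) else 0) (N : ℕ)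
    (hN : N < Fintype.card Λ) (hsec : ψ ∈ spinZSector 1 ((N : ℝ) - (Fintype.card Λ : ℝ) / 2)) :
    Φ ∈ spinZSector 1 (((N + 1 : ℕ) : ℝ) - (Fintype.card Λ : ℝ) / 2) := by
  have hW : ∀ k : ℕ, k ≤ Fintype.card Λ →
      ((Fintype.card Λ * 1 : ℕ) : ℝ) / 2 - ((Fintype.card Λ - k : ℕ) : ℝ) =
        (k : ℝ) - (Fintype.card Λ : ℝ) / 2 := by
    intro k hk
    rw [Nat.cast_sub hk]
    push_cast
    ring
  have hψ : ∀ σ : TensorIndex Λ 2, (∑ z, (σ z : ℕ)) ≠ Fintype.card Λ - N → ψ σ = 0 := by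
    rw [← hW N hN.le] at hsec
    exact (LiebMattis.mem_spinZSector_weight_iff 1 (Fintype.card Λ - N) ψ).1 hsec
  rw [← hW (N + 1) hN, LiebMattis.mem_spinZSector_weight_iff]
  intro σ hσ
  rw [hΦ]
  refine Finset.sum_eq_zero fun x _ => ?_
  split_ifs with hx
  · refine hψ _ fun h => hσ ?_
    rw [cb2po_weight_update hx] at h
    omega
  · rfl

end Sector

section Registered

/-- **Registered sub-goal `stub_poAveragingFloors`** (helper of `stub_poAveraging`, line
`cosh-budget-penrose-onsager`): the two hypotheses of `stub_poAveraging` at an admissible level-`N`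
datum (`2 ≤ N ≤ L³`; sector, nonzero, entrywise real nonnegative — no eigen-equation needed) force
`2L³ ≤ (L³ - N + 2)·M` and `2L³ ≤ (L³ - N + 1)·M₁`: both constants are at least the Cauchy–Schwarz
floors (`≥ 2`), so `max M M₁ > 0` and the flat components of the PO mixtures (flatness exactly
`2L³/#support`) cost at most the floor shift `(L³-N+2)/(L³-N+1) ≤ 1 + 2/L³`. [folklore] -/
theorem stub_poAveragingFloors :
    ∀ (L : ℕ) [NeZero L] (N : ℕ), 2 ≤ N → N ≤ L ^ 3 →
      ∀ (M M₁ : ℝ) (ψ' : TensorIndex (TorusSite 3 L) 2 → ℂ),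
        (ψ' ∈ spinZSector 1 (((N : ℕ) : ℝ) - (L : ℝ) ^ 3 / 2) ∧ ψ' ≠ 0 ∧
          ∀ σ, 0 ≤ (ψ' σ).re ∧ (ψ' σ).im = 0) →
        (K1Ineq M L N ψ' → 2 * (L : ℝ) ^ 3 ≤ ((L : ℝ) ^ 3 - N + 2) * M) ∧
        (((L : ℝ) ^ 3 * ∑ T ∈ (univ : Finset (TorusSite 3 L)).powersetCard (N - 1),
            K1lhs (fun x => if x ∉ T then ((ψ') (fun z => if z ∈ insert x T then 0 else 1)).re else 0) ≤
          (M₁) * ∑ T ∈ (univ : Finset (TorusSite 3 L)).powersetCard (N - 1),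
            K1rhs (fun x => if x ∉ T then ((ψ') (fun z => if z ∈ insert x T then 0 else 1)).re else 0)) →
          2 * (L : ℝ) ^ 3 ≤ ((L : ℝ) ^ 3 - N + 1) * M₁) := by
  intro L _ N hN hNL M M₁ ψ' hψ'
  exact ⟨fun hK => cb2po_floor_le_const hN hNL hψ'.1 hψ'.2.1 hψ'.2.2 hK,
    fun hK => cb2po_floor_le_const_one (by omega) hNL hψ'.1 hψ'.2.1 hψ'.2.2 hK⟩

end Registered

end Summit.AtomisticToContinuum.BoseEinsteinCondensation.Cruxes.InsertionFieldDelocalisation.CoshBudgetPenroseOnsager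

end
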